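import Literature.NumberTheory.Transcendental.NesterenkoEliminationFacts
import Literature.RingTheory.GradedAlgebra.HomogeneousAssociatedPrimes
import Literature.RingTheory.KrullDimension.FibreInequality
import Mathlib.RingTheory.Nullstellensatz
import Mathlib.Algebra.MvPolynomial.Nilpotent
import HarnessLib

/-!
# Nesterenko's Proposition 4.4 (LNM 1752 Ch. 3 §4): structural lemmas and its reduction to four classical inputs

Topic `Literature/NumberTheory/Transcendental`. Companion of `NesterenkoElimination.lean` (the
definitions: `Ī(r) = elimIdeal I r`, `(I, L₁, …, L_r) = extIdeal I r`, the associated form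
`chowForm`, `blockDeg`, `ideg`, …) and of `NesterenkoEliminationFacts.lean`, where Proposition 4.4
of Yu. V. Nesterenko's "algebraic fundamentals" (Nesterenko–Philippon (eds.), LNM 1752 (2001),
Ch. 3 §4, p. 38) is vendored as the named fact `NesterenkoPhilippon2001_ch3_prop_4_4`. The book
gives no proof ("See [Nes2] and Chapter 6"; [Nes2] = Nesterenko, Izv. Akad. Nauk SSSR Ser. Mat. 41
(1977) = `Nesterenko1977`, §1; Chapter 6 is Philippon's multiprojective elimination theory, a
different framework). Everything in this file is PROVED:

* elementary API of `Ī(r)`: monotonicity (`elimIdeal_mono`), the specialisation `u ↦ 0`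
  (`killU`) and `𝔭̄(r) ≠ (1)` for a prime not containing the irrelevant ideal (`elimIdeal_ne_top`,
  Philippon, Publ. Math. IHÉS 64 (1986), Prop. 1.3 (i)–(ii)), and `(x₀, …, x_m) ⊄ 𝔭` when
  `dim ℚ[x̲]/𝔭 = r ≥ 1` (`not_span_range_X_le`);
* the SYMMETRY of `Ī(r)` under the permutations of the blocks `u₁, …, u_r` (Hodge–Pedoe II,
  Ch. X §6: "the interchange of `u_ρ` with `u_σ` produces at most a change of sign in the Cayley
  form"): `rename_blockPerm_mem_elimIdeal_iff`, `map_rename_blockPerm_elimIdeal`, whence the last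
  clause of Prop. 4.4 — all block degrees `deg_{uᵢ} F` of the associated form agree with
  `deg I = deg_{u₁} F` — holds outright: `blockDeg_chowForm_eq_ideg` (a generator of a principal
  ideal stable under a ring automorphism is mapped to a unit multiple of itself; units of `ℚ[U]` are
  constants);
* `⋂ᵢ (πᵢ^{nᵢ}) = (∏ᵢ πᵢ^{nᵢ})` for pairwise non-associated prime elements of a domain
  (`iInf_span_singleton_pow_eq_span_prod`);
* **`NesterenkoPhilippon2001_ch3_prop_4_4_of`**: Proposition 4.4 FOLLOWS from four classical
  statements taken as explicit hypotheses (they are not vendored as named facts here):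
  (1) Philippon 1986, Prop. 1.3 (ii),(iv) (`𝔭̄(r)` is prime for a homogeneous prime `𝔭 ⊉ (x̲)`;
  `Ī(r) = ⋂ Ī_h(r)` over a reduced primary decomposition); (2) Philippon 1986, Prop. 1.5 (ii)–(iii)
  = Hodge–Pedoe X §6 Thm. I (`𝔭̄(r)` is principal and non-zero when `dim 𝔭 = r − 1`); (3) the
  exponent law `Ī_j(r) = (F_j^{k_j})` for a primary component ([Nes2] §1; Philippon states only
  `≤` and refers to Nesterenko for equality, Remarque after Prop. 1.3); (4) distinct homogeneous
  primes of the same dimension have distinct `𝔭̄(r)` (Hodge–Pedoe X §7: "no two distinct varieties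
  can have the same Cayley form"). The deduction: the radicals `√Q` (`Q ∈ t`) are the associated
  primes of `I` (first uniqueness theorem, Mathlib), hence homogeneous
  (`Literature.RingTheory.GradedAlgebra.isHomogeneous_of_mem_associatedPrimes`) primes of
  dimension `r − 1` not containing `(x̲)`; so each `p̄_j(r) = (F_j)` is a non-zero proper principal
  prime ideal, each `F_j` is a prime element (irreducible), the `F_j` are pairwise non-associated by
  (4), and `Ī(r) = ⋂ⱼ Ī_j(r) = ⋂ⱼ (F_j^{k_j}) = (∏ⱼ F_j^{k_j})`.

Deliberately NOT here: proofs of the inputs (1)–(4) (the theory of Chow forms: Philippon's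
Lemma 1.2 localisation description of `Ī(r)`, generic linear forms and transcendence degrees,
Nesterenko's exponent law); they are the subject of separate files.

## References

* [NesterenkoPhilippon2001] LNM 1752 (2001), Ch. 3 (Yu. V. Nesterenko) §4, Prop. 4.4 and the
  paragraph following it (p. 38; PDF p. 50).
* [Nesterenko1977] Yu. V. Nesterenko, Izv. Akad. Nauk SSSR Ser. Mat. 41 (1977) 253–284
  (= Math. USSR-Izv. 11 (1977) 239–270), §1 — the [Nes2] of LNM 1752.
* [Philippon1986Criteres] P. Philippon, *Critères pour l'indépendance algébrique*, Publ. Math.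
  IHÉS 64 (1986) 5–52, §1: Déf. 1.1, Lemme 1.2, Prop. 1.3, Prop. 1.4, Prop. 1.5 (pp. 9–14).
* [HodgePedoe1994] W. V. D. Hodge, D. Pedoe, *Methods of Algebraic Geometry* II (CUP 1952, repr.
  1994), Ch. X §§6–8 (the Cayley form; §6: symmetry and multihomogeneity, Thm. I;
  §7: "no two distinct varieties can have the same Cayley form").
-/

noncomputable section

open MvPolynomial

attribute [local instance] MvPolynomial.gradedAlgebra

namespace Literature.NumberTheory.Transcendental

namespace Nesterenko

variable {m : ℕ}

/-! ### Monotonicity of `(I, L₁, …, L_r)` and of `Ī(r)` -/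

/-- `I ⊆ J ⇒ (I, L) ⊆ (J, L)`. [folklore] -/
theorem extIdeal_mono {I J : Ideal (Rx m)} (h : I ≤ J) (r : ℕ) : extIdeal I r ≤ extIdeal J r :=
  sup_le_sup_right (Ideal.map_mono h) _

/-- `I ⊆ J ⇒ Ī(r) ⊆ J̄(r)`. [folklore] -/
theorem elimIdeal_mono {I J : Ideal (Rx m)} (h : I ≤ J) (r : ℕ) : elimIdeal I r ≤ elimIdeal J r := by
  rintro G ⟨M, hM, hG⟩
  exact ⟨M, hM, fun j => extIdeal_mono h r (hG j)⟩

/-! ### The specialisation `u ↦ 0`: `Ī(r)` is a proper ideal unless `I` contains powers of all the `xⱼ` -/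

/-- The `ℚ`-algebra map `ℚ[U, x̲] → ℚ[x̲]` sending every `u_{ij}` to `0` and `xⱼ` to `xⱼ`. [folklore] -/
def killU (r m : ℕ) : RUX r m →ₐ[ℚ] Rx m :=
  aeval (Sum.elim (fun _ => 0) X)

/-- `u_{ij} ↦ 0`. [folklore] -/
@[simp] theorem killU_X_inl (r : ℕ) (ij : Fin r × Fin (m + 1)) :
    killU r m (X (Sum.inl ij)) = 0 := by
  simp [killU]

/-- `xⱼ ↦ xⱼ`. [folklore] -/
@[simp] theorem killU_X_inr (r : ℕ) (j : Fin (m + 1)) : killU r m (X (Sum.inr j)) = X j := by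
  simp [killU]

/-- `u ↦ 0` is the identity on `ℚ[x̲] ⊆ ℚ[U, x̲]`. [folklore] -/
theorem killU_rename_inr (r : ℕ) (p : Rx m) : killU r m (rename Sum.inr p) = p := by
  rw [killU, aeval_rename]
  simp [Function.comp_def]

/-- `u ↦ 0` kills the linear forms `Lᵢ`. [folklore] -/
@[simp] theorem killU_linForm (r : ℕ) (i : Fin r) : killU r m (linForm r m i) = 0 := by
  simp [linForm, map_sum]

/-- `u ↦ 0` maps `(I, L₁, …, L_r)` into `I`. [folklore] -/
theorem killU_mem_of_mem_extIdeal {I : Ideal (Rx m)} {r : ℕ} {P : RUX r m} (hP : P ∈ extIdeal I r) :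
    killU r m P ∈ I := by
  have hle : extIdeal I r ≤ I.comap (killU r m) := by
    refine sup_le ?_ ?_
    · rw [Ideal.map_le_iff_le_comap]
      intro p hp
      simpa [Ideal.mem_comap, killU_rename_inr] using hp
    · rw [Ideal.span_le]
      rintro _ ⟨i, rfl⟩
      simp
  exact hle hP

/-- If `Ī(r) = (1)` then every `xⱼ` has a power in `I` (specialise `u ↦ 0` in
`xⱼ^M ∈ (I, L₁, …, L_r)`). [folklore] -/
theorem exists_X_pow_mem_of_elimIdeal_eq_top {I : Ideal (Rx m)} {r : ℕ} (h : elimIdeal I r = ⊤)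
    (j : Fin (m + 1)) : ∃ M : ℕ, (X j : Rx m) ^ M ∈ I := by
  have h1 : (1 : RU r m) ∈ elimIdeal I r := by rw [h]; exact Submodule.mem_top
  obtain ⟨M, -, hM⟩ := h1
  refine ⟨M, ?_⟩
  have := killU_mem_of_mem_extIdeal (hM j)
  simpa using this

/-- For a prime `𝔭` not containing the irrelevant ideal `(x₀, …, x_m)`, `𝔭̄(r) ≠ (1)`.
[cite: Philippon1986Criteres, Prop. 1.3 (i)–(ii) (p. 10)] -/
theorem elimIdeal_ne_top {𝔭 : Ideal (Rx m)} (h𝔭 : 𝔭.IsPrime)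
    (hirr : ¬ Ideal.span (Set.range (X : Fin (m + 1) → Rx m)) ≤ 𝔭) (r : ℕ) :
    elimIdeal 𝔭 r ≠ ⊤ := by
  intro h
  apply hirr
  rw [Ideal.span_le]
  rintro _ ⟨j, rfl⟩
  obtain ⟨M, hM⟩ := exists_X_pow_mem_of_elimIdeal_eq_top h j
  exact h𝔭.mem_of_pow_mem M hM

/-- The irrelevant ideal `(x₀, …, x_m)` is the (maximal) ideal of the origin. [folklore] -/
theorem span_range_X_eq_vanishingIdeal :
    Ideal.span (Set.range (X : Fin (m + 1) → Rx m)) = MvPolynomial.vanishingIdeal ℚ {(0 : Fin (m + 1) → ℚ)} := by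
  rw [Literature.RingTheory.KrullDimension.vanishingIdeal_singleton_eq_span]
  simp

/-- A proper ideal `𝔭` with `dim ℚ[x̲]/𝔭 = r ≥ 1` does not contain the irrelevant ideal (which is
maximal, with zero-dimensional quotient). [folklore] -/
theorem not_span_range_X_le {𝔭 : Ideal (Rx m)} (h𝔭 : 𝔭 ≠ ⊤) {r : ℕ} (hr : 1 ≤ r)
    (hdim : ringKrullDim (Rx m ⧸ 𝔭) = r) :
    ¬ Ideal.span (Set.range (X : Fin (m + 1) → Rx m)) ≤ 𝔭 := by
  intro hle
  rw [span_range_X_eq_vanishingIdeal] at hle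
  have hmax : (MvPolynomial.vanishingIdeal ℚ {(0 : Fin (m + 1) → ℚ)} : Ideal (Rx m)).IsMaximal :=
    inferInstance
  have heq := hmax.eq_of_le h𝔭 hle
  haveI : 𝔭.IsMaximal := heq ▸ hmax
  letI : Field (Rx m ⧸ 𝔭) := Ideal.Quotient.field 𝔭
  have h0 : ringKrullDim (Rx m ⧸ 𝔭) = 0 := ringKrullDim_eq_zero_of_field _
  rw [hdim] at h0
  have : (r : WithBot ℕ∞) = ((0 : ℕ) : WithBot ℕ∞) := by simpa using h0
  have : r = 0 := by exact_mod_cast this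
  omega

/-! ### Symmetry of `Ī(r)` under permutations of the blocks `u₁, …, u_r` -/

/-- Permuting the blocks of variables `u₁, …, u_r` of `ℚ[U]` by `σ ∈ S_r`. [folklore] -/
def blockPerm {r : ℕ} (σ : Equiv.Perm (Fin r)) : (Fin r × Fin (m + 1)) ≃ (Fin r × Fin (m + 1)) :=
  Equiv.prodCongr σ (Equiv.refl _)

/-- The same permutation on the variables of `ℚ[U, x̲]`, fixing the `xⱼ`. [folklore] -/
def blockPermX {r : ℕ} (σ : Equiv.Perm (Fin r)) :
    ((Fin r × Fin (m + 1)) ⊕ Fin (m + 1)) ≃ ((Fin r × Fin (m + 1)) ⊕ Fin (m + 1)) :=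
  Equiv.sumCongr (blockPerm σ) (Equiv.refl _)

/-- `σ · u_{ij} = u_{σ(i) j}`. [folklore] -/
@[simp] theorem blockPerm_apply {r : ℕ} (σ : Equiv.Perm (Fin r)) (i : Fin r) (j : Fin (m + 1)) :
    blockPerm (m := m) σ (i, j) = (σ i, j) := rfl

/-- The inverse block permutation. [folklore] -/
@[simp] theorem blockPerm_symm_apply {r : ℕ} (σ : Equiv.Perm (Fin r)) (i : Fin r) (j : Fin (m + 1)) :
    (blockPerm (m := m) σ).symm (i, j) = (σ.symm i, j) := rfl

/-- On the `u`-variables `blockPermX` is `blockPerm`. [folklore] -/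
@[simp] theorem blockPermX_inl {r : ℕ} (σ : Equiv.Perm (Fin r)) (ij : Fin r × Fin (m + 1)) :
    blockPermX (m := m) σ (Sum.inl ij) = Sum.inl (blockPerm σ ij) := rfl

/-- `blockPermX` fixes the `xⱼ`. [folklore] -/
@[simp] theorem blockPermX_inr {r : ℕ} (σ : Equiv.Perm (Fin r)) (j : Fin (m + 1)) :
    blockPermX (m := m) (r := r) σ (Sum.inr j) = Sum.inr j := rfl

/-- `blockPermX ∘ inl = inl ∘ blockPerm`. [folklore] -/
theorem blockPermX_comp_inl {r : ℕ} (σ : Equiv.Perm (Fin r)) :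
    (blockPermX (m := m) σ) ∘ Sum.inl = Sum.inl ∘ blockPerm σ := rfl

/-- `blockPermX ∘ inr = inr`. [folklore] -/
theorem blockPermX_comp_inr {r : ℕ} (σ : Equiv.Perm (Fin r)) :
    (blockPermX (m := m) (r := r) σ) ∘ Sum.inr = Sum.inr := rfl

/-- `blockPerm` is multiplicative. [folklore] -/
theorem blockPerm_trans {r : ℕ} (σ τ : Equiv.Perm (Fin r)) :
    (blockPerm (m := m) σ).trans (blockPerm τ) = blockPerm (σ.trans τ) := by
  ext ⟨i, j⟩ <;> rfl

/-- `blockPermX σ⁻¹` undoes `blockPermX σ`. [folklore] -/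
theorem blockPermX_symm_comp {r : ℕ} (σ : Equiv.Perm (Fin r)) :
    (blockPermX (m := m) σ⁻¹) ∘ (blockPermX (m := m) σ) = id := by
  funext x
  rcases x with ⟨i, j⟩ | j <;> simp

/-- `blockPerm σ⁻¹` undoes `blockPerm σ`. [folklore] -/
theorem blockPerm_symm_comp {r : ℕ} (σ : Equiv.Perm (Fin r)) :
    (blockPerm (m := m) σ⁻¹) ∘ (blockPerm (m := m) σ) = id := by
  funext ⟨i, j⟩
  simp

/-- Permuting the blocks permutes the linear forms: `σ · Lᵢ = L_{σ i}`. [folklore] -/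
theorem rename_blockPermX_linForm {r : ℕ} (σ : Equiv.Perm (Fin r)) (i : Fin r) :
    rename (blockPermX (m := m) σ) (linForm r m i) = linForm r m (σ i) := by
  simp [linForm, map_sum]

/-- `(I, L₁, …, L_r)` is stable under permuting the blocks. [folklore] -/
theorem rename_blockPermX_mem_extIdeal {I : Ideal (Rx m)} {r : ℕ} (σ : Equiv.Perm (Fin r))
    {P : RUX r m} (hP : P ∈ extIdeal I r) : rename (blockPermX σ) P ∈ extIdeal I r := by
  have hle : extIdeal I r ≤ (extIdeal I r).comap (rename (blockPermX (m := m) σ)) := by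
    refine sup_le ?_ ?_
    · rw [Ideal.map_le_iff_le_comap]
      intro p hp
      rw [Ideal.mem_comap, Ideal.mem_comap, rename_rename, blockPermX_comp_inr]
      exact Ideal.mem_sup_left (Ideal.mem_map_of_mem _ hp)
    · rw [Ideal.span_le]
      rintro _ ⟨i, rfl⟩
      rw [SetLike.mem_coe, Ideal.mem_comap, rename_blockPermX_linForm]
      exact Ideal.mem_sup_right (Ideal.subset_span ⟨σ i, rfl⟩)
  exact hle hP

/-- `(I, L₁, …, L_r)` is stable under permuting the blocks (iff form). [folklore] -/
theorem rename_blockPermX_mem_extIdeal_iff {I : Ideal (Rx m)} {r : ℕ} (σ : Equiv.Perm (Fin r))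
    (P : RUX r m) : rename (blockPermX σ) P ∈ extIdeal I r ↔ P ∈ extIdeal I r := by
  refine ⟨fun h => ?_, rename_blockPermX_mem_extIdeal σ⟩
  have := rename_blockPermX_mem_extIdeal σ⁻¹ h
  rwa [rename_rename, blockPermX_symm_comp, rename_id] at this

/-- `Ī(r)` is stable under permuting the blocks `u₁, …, u_r`.
[cite: HodgePedoe1994, vol. II, Ch. X §6] -/
theorem rename_blockPerm_mem_elimIdeal_iff {I : Ideal (Rx m)} {r : ℕ} (σ : Equiv.Perm (Fin r))
    (G : RU r m) : rename (blockPerm σ) G ∈ elimIdeal I r ↔ G ∈ elimIdeal I r := by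
  have key : ∀ (M : ℕ) (j : Fin (m + 1)),
      rename Sum.inl (rename (blockPerm (m := m) σ) G) * X (Sum.inr j) ^ M =
        rename (blockPermX σ) (rename Sum.inl G * X (Sum.inr j) ^ M) := by
    intro M j
    rw [map_mul, map_pow, rename_X, blockPermX_inr, rename_rename, rename_rename,
      blockPermX_comp_inl]
  simp only [mem_elimIdeal_iff, key, rename_blockPermX_mem_extIdeal_iff]

/-- `σ · Ī(r) = Ī(r)` as ideals of `ℚ[U]`. [cite: HodgePedoe1994, vol. II, Ch. X §6] -/
theorem map_rename_blockPerm_elimIdeal (I : Ideal (Rx m)) {r : ℕ} (σ : Equiv.Perm (Fin r)) :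
    (elimIdeal I r).map (rename (blockPerm (m := m) σ)) = elimIdeal I r := by
  apply le_antisymm
  · rw [Ideal.map_le_iff_le_comap]
    intro G hG
    rw [Ideal.mem_comap]
    exact (rename_blockPerm_mem_elimIdeal_iff σ G).2 hG
  · intro G hG
    have hG' : rename (blockPerm (m := m) σ⁻¹) G ∈ elimIdeal I r :=
      (rename_blockPerm_mem_elimIdeal_iff σ⁻¹ G).2 hG
    have e : rename (blockPerm (m := m) σ) (rename (blockPerm (m := m) σ⁻¹) G) = G := by
      rw [rename_rename]
      have : (blockPerm (m := m) σ) ∘ (blockPerm (m := m) σ⁻¹) = id := by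
        funext ⟨i, j⟩; simp
      rw [this, rename_id]
      rfl
    rw [← e]
    exact Ideal.mem_map_of_mem _ hG'

/-- The degree in the block `uᵢ` of `F ∘ σ` is the degree of `F` in the block `u_{σ⁻¹ i}`. [folklore] -/
theorem blockDeg_rename_blockPerm {r : ℕ} (σ : Equiv.Perm (Fin r)) (F : RU r m) (i : Fin r) :
    blockDeg (rename (blockPerm σ) F) i = blockDeg F (σ.symm i) := by
  classical
  unfold blockDeg
  rw [support_rename_of_injective (blockPerm σ).injective, Finset.sup_image]
  congr 1
  funext d
  simp only [Function.comp_apply]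
  refine Finset.sum_congr rfl fun j _ => ?_
  rw [Finsupp.mapDomain_equiv_apply, blockPerm_symm_apply]

/-- Multiplying by a non-zero constant does not change block degrees. [folklore] -/
theorem blockDeg_mul_C {r : ℕ} (F : RU r m) {c : ℚ} (hc : c ≠ 0) (i : Fin r) :
    blockDeg (F * C c) i = blockDeg F i := by
  unfold blockDeg
  rw [mul_comm, ← smul_eq_C_mul, support_smul_eq hc]

/-- `deg_{uᵢ} 0 = 0` (`Finset.sup ∅ = 0`). [folklore] -/
@[simp] theorem blockDeg_zero {r : ℕ} (i : Fin r) : blockDeg (0 : RU r m) i = 0 := by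
  simp [blockDeg]

/-- The associated form is symmetric in `u₁, …, u_r` up to a unit: all its block degrees agree
(the remark after Prop. 4.4: "`F` is symmetric in `u̲ᵢ, 1 ≤ i ≤ r`"; in the junk case `Ī(r)` not
principal, `chowForm I r = 0` and both sides vanish).
[cite: NesterenkoPhilippon2001, Ch. 3, paragraph after Prop. 4.4 (p. 38)] -/
theorem blockDeg_chowForm_eq (I : Ideal (Rx m)) {r : ℕ} (i i' : Fin r) :
    blockDeg (chowForm I r) i = blockDeg (chowForm I r) i' := by
  classical
  by_cases h : (elimIdeal I r).IsPrincipal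
  · set F := chowForm I r with hF
    have hspan : Ideal.span {F} = elimIdeal I r := span_chowForm I r h
    set σ : Equiv.Perm (Fin r) := Equiv.swap i i' with hσ
    have hspan' : Ideal.span {rename (blockPerm (m := m) σ) F} = elimIdeal I r := by
      rw [← Set.image_singleton, ← Ideal.map_span, hspan, map_rename_blockPerm_elimIdeal]
    have hass : Associated (rename (blockPerm (m := m) σ) F) F := by
      rw [← Ideal.span_singleton_eq_span_singleton, hspan, hspan']
    obtain ⟨u, hu⟩ := hass
    obtain ⟨c, hc, hcu⟩ := (MvPolynomial.isUnit_iff_eq_C_of_isReduced).1 u.isUnit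
    have hc0 : c ≠ 0 := hc.ne_zero
    calc blockDeg F i = blockDeg F (σ.symm i') := by simp [hσ]
      _ = blockDeg (rename (blockPerm (m := m) σ) F) i' := (blockDeg_rename_blockPerm σ F i').symm
      _ = blockDeg (rename (blockPerm (m := m) σ) F * C c) i' := (blockDeg_mul_C _ hc0 i').symm
      _ = blockDeg F i' := by rw [← hcu, hu]
  · have h0 : chowForm I r = 0 := by rw [chowForm, dif_neg h]
    simp [h0]

/-- **The symmetry clause of Prop. 4.4**: all block degrees `deg_{uᵢ} F` of the associated form
equal `deg I = deg_{u₁} F`. [cite: NesterenkoPhilippon2001, Ch. 3, paragraph after Prop. 4.4 and Def. 4.5 (p. 38)] -/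
theorem blockDeg_chowForm_eq_ideg (I : Ideal (Rx m)) {r : ℕ} (hr : 0 < r) (i : Fin r) :
    blockDeg (chowForm I r) i = ideg I r := by
  rw [ideg, dif_pos hr]
  exact blockDeg_chowForm_eq I i ⟨0, hr⟩

/-! ### Intersections of principal ideals generated by powers of non-associated primes -/

section UFD

variable {R : Type*} [CommRing R] [IsDomain R]

/-- `(πⁿ) ∩ (b) = (πⁿ b)` for a prime element `π` not dividing `b`. [folklore] -/
theorem span_singleton_pow_inf_span_singleton_of_not_dvd {π b : R} (hπ : Prime π) (n : ℕ)
    (h : ¬ π ∣ b) : Ideal.span {π ^ n} ⊓ Ideal.span {b} = Ideal.span {π ^ n * b} := by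
  apply le_antisymm
  · rintro x ⟨hx₁, hx₂⟩
    obtain ⟨c, rfl⟩ := Ideal.mem_span_singleton'.1 (show x ∈ Ideal.span {π ^ n} from hx₁)
    obtain ⟨d, hd⟩ := Ideal.mem_span_singleton'.1 (show c * π ^ n ∈ Ideal.span {b} from hx₂)
    -- `d b = c πⁿ`, so `πⁿ ∣ d`
    have hdvd : π ^ n ∣ d * b := ⟨c, by rw [hd, mul_comm]⟩
    obtain ⟨d', rfl⟩ := hπ.pow_dvd_of_dvd_mul_right n h hdvd
    refine Ideal.mem_span_singleton'.2 ⟨d', ?_⟩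
    rw [← hd]
    ring
  · rw [le_inf_iff]
    exact ⟨Ideal.span_singleton_le_span_singleton.2 (dvd_mul_right _ b),
      Ideal.span_singleton_le_span_singleton.2 (dvd_mul_left b _)⟩

/-- `⋂ᵢ (πᵢ^{nᵢ}) = (∏ᵢ πᵢ^{nᵢ})` for finitely many pairwise non-dividing prime elements `πᵢ`
(lcm of pairwise coprime prime powers in a factorial domain). [folklore] -/
theorem iInf_span_singleton_pow_eq_span_prod {ι : Type*} (s : Finset ι) (π : ι → R) (n : ι → ℕ)
    (hπ : ∀ i ∈ s, Prime (π i)) (hne : ∀ i ∈ s, ∀ j ∈ s, i ≠ j → ¬ π i ∣ π j) :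
    ⨅ i ∈ s, Ideal.span {π i ^ n i} = Ideal.span {∏ i ∈ s, π i ^ n i} := by
  classical
  induction s using Finset.induction_on with
  | empty => simp
  | insert i s hi ih =>
    rw [Finset.iInf_insert, Finset.prod_insert hi,
      ih (fun j hj => hπ j (Finset.mem_insert_of_mem hj))
        (fun j hj k hk => hne j (Finset.mem_insert_of_mem hj) k (Finset.mem_insert_of_mem hk))]
    refine span_singleton_pow_inf_span_singleton_of_not_dvd (hπ i (Finset.mem_insert_self i s))
      (n i) ?_
    intro hdvd
    obtain ⟨j, hj, hij⟩ :=
      (Prime.dvd_finsetProd_iff (hπ i (Finset.mem_insert_self i s)) _).1 hdvd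
    exact hne i (Finset.mem_insert_self i s) j (Finset.mem_insert_of_mem hj)
      (fun e => hi (e ▸ hj)) ((hπ i (Finset.mem_insert_self i s)).dvd_of_dvd_pow hij)

end UFD

/-! ### Deduction of Proposition 4.4 from four classical inputs -/

/-- **Reduction of LNM 1752 Ch. 3 Prop. 4.4 to four classical inputs**, taken as hypotheses
(`h1`: Philippon, Publ. Math. IHÉS 64 (1986), Prop. 1.3 (ii),(iv) for `d = (1,…,1)`, `R = ℚ`, where
Philippon's `𝔈_d(I)` is `Ī(r)`; `h2`: ibid. Prop. 1.5 (ii)–(iii) (= Prop. 4.4 for `I = 𝔭` prime;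
Hodge–Pedoe II, Ch. X §6 Thm. I); `h3`: the exponent law `Ī_j(r) = (F_j^{k_j})` for a primary
component ([Nes2] §1; Philippon's Remarque after Prop. 1.3); `h4`: "no two distinct varieties have
the same Cayley form" (Hodge–Pedoe II, Ch. X §7)), with the symmetry clause proved outright
(`blockDeg_chowForm_eq_ideg`). The glue: the radicals `√Q`, `Q ∈ t`,
are the associated primes of `I` (first uniqueness theorem), hence homogeneous primes of dimension
`r − 1` not containing `(x̲)`; so each `p̄_j(r) = (F_j)` is a non-zero proper principal prime ideal,
`F_j` is irreducible, and `Ī(r) = ⋂ Ī_j(r) = ⋂ (F_j^{k_j}) = (∏ F_j^{k_j})`, the `F_j` being pairwise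
non-associated. [cite: NesterenkoPhilippon2001, Ch. 3 Prop. 4.4 (p. 38)] -/
theorem NesterenkoPhilippon2001_ch3_prop_4_4_of
    -- (1) Philippon 1986 Prop. 1.3 (ii),(iv): `𝔭̄(r)` prime; `Ī(r) = ⋂ Ī_h(r)`
    (h1 : ∀ (m r : ℕ), 1 ≤ r → r ≤ m →
      (∀ 𝔭 : Ideal (Rx m), 𝔭.IsHomogeneous (homogeneousSubmodule (Fin (m + 1)) ℚ) → 𝔭.IsPrime →
          ¬ Ideal.span (Set.range (X : Fin (m + 1) → Rx m)) ≤ 𝔭 → (elimIdeal 𝔭 r).IsPrime) ∧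
      (∀ I : Ideal (Rx m), I.IsHomogeneous (homogeneousSubmodule (Fin (m + 1)) ℚ) →
          ∀ t : Finset (Ideal (Rx m)), Submodule.IsMinimalPrimaryDecomposition I t →
            elimIdeal I r = ⨅ Q ∈ t, elimIdeal Q r))
    -- (2) Philippon 1986 Prop. 1.5 (ii)–(iii): `𝔭̄(r)` principal and non-zero
    (h2 : ∀ (m r : ℕ) (𝔭 : Ideal (Rx m)), 1 ≤ r → r ≤ m →
      𝔭.IsHomogeneous (homogeneousSubmodule (Fin (m + 1)) ℚ) → 𝔭.IsPrime →
      ringKrullDim (Rx m ⧸ 𝔭) = r → (elimIdeal 𝔭 r).IsPrincipal ∧ elimIdeal 𝔭 r ≠ ⊥)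
    -- (3) [Nes2] §1, the exponent law for a primary component: `Ī_j(r) = (F_j^{k_j})`
    (h3 : ∀ (m r : ℕ) (I : Ideal (Rx m)), 1 ≤ r → r ≤ m →
      I.IsHomogeneous (homogeneousSubmodule (Fin (m + 1)) ℚ) → IsUnmixedOfRank I r →
      ∀ t : Finset (Ideal (Rx m)), Submodule.IsMinimalPrimaryDecomposition I t →
        ∀ Q ∈ t, ∀ F : RU r m, Ideal.span {F} = elimIdeal Q.radical r →
          Ideal.span {F ^ primaryExponent Q} = elimIdeal Q r)
    -- (4) Hodge–Pedoe X §7: distinct primes of equal dimension have distinct `𝔭̄(r)`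
    (h4 : ∀ (m r : ℕ) (𝔭 𝔭' : Ideal (Rx m)), 1 ≤ r → r ≤ m →
      𝔭.IsHomogeneous (homogeneousSubmodule (Fin (m + 1)) ℚ) → 𝔭.IsPrime →
      ringKrullDim (Rx m ⧸ 𝔭) = r →
      𝔭'.IsHomogeneous (homogeneousSubmodule (Fin (m + 1)) ℚ) → 𝔭'.IsPrime →
      ringKrullDim (Rx m ⧸ 𝔭') = r →
      elimIdeal 𝔭 r = elimIdeal 𝔭' r → 𝔭 = 𝔭') :
    NesterenkoPhilippon2001_ch3_prop_4_4 := by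
  classical
  intro m r I hr hrm hI hunm t ht
  -- the radicals of the components are the associated primes of `I`
  have hrad : ∀ Q ∈ t, Q.radical ∈ I.associatedPrimes := fun Q hQ => by
    have h := ht.mem_associatedPrimes hQ
    rwa [Submodule.colon_univ] at h
  have hprime : ∀ Q ∈ t, Q.radical.IsPrime := fun Q hQ => Ideal.isPrime_radical (ht.primary hQ)
  have hdim : ∀ Q ∈ t, ringKrullDim (Rx m ⧸ Q.radical) = r := fun Q hQ => hunm.2 _ (hrad Q hQ)
  have hhom : ∀ Q ∈ t, Q.radical.IsHomogeneous (homogeneousSubmodule (Fin (m + 1)) ℚ) :=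
    fun Q hQ => Literature.RingTheory.GradedAlgebra.isHomogeneous_of_mem_associatedPrimes
      (homogeneousSubmodule (Fin (m + 1)) ℚ) hI (hrad Q hQ)
  have hirr : ∀ Q ∈ t, ¬ Ideal.span (Set.range (X : Fin (m + 1) → Rx m)) ≤ Q.radical :=
    fun Q hQ => not_span_range_X_le (hprime Q hQ).ne_top hr (hdim Q hQ)
  have helimPrime : ∀ Q ∈ t, (elimIdeal Q.radical r).IsPrime :=
    fun Q hQ => (h1 m r hr hrm).1 _ (hhom Q hQ) (hprime Q hQ) (hirr Q hQ)
  have hprinc : ∀ Q ∈ t, (elimIdeal Q.radical r).IsPrincipal ∧ elimIdeal Q.radical r ≠ ⊥ :=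
    fun Q hQ => h2 m r _ hr hrm (hhom Q hQ) (hprime Q hQ) (hdim Q hQ)
  -- generators of the `p̄_j(r)` are prime elements, pairwise non-associated
  have hgenPrime : ∀ F : Ideal (Rx m) → RU r m,
      (∀ Q ∈ t, Ideal.span {F Q} = elimIdeal Q.radical r) → ∀ Q ∈ t, Prime (F Q) := by
    intro F hF Q hQ
    have hF0 : F Q ≠ 0 := by
      intro h0
      apply (hprinc Q hQ).2
      rw [← hF Q hQ, h0, Ideal.span_singleton_eq_bot]
    rw [← Ideal.span_singleton_prime hF0, hF Q hQ]
    exact helimPrime Q hQ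
  have hgenNotDvd : ∀ F : Ideal (Rx m) → RU r m,
      (∀ Q ∈ t, Ideal.span {F Q} = elimIdeal Q.radical r) →
        ∀ Q ∈ t, ∀ Q' ∈ t, Q ≠ Q' → ¬ F Q ∣ F Q' := by
    intro F hF Q hQ Q' hQ' hne hdvd
    have hass : Associated (F Q) (F Q') :=
      (hgenPrime F hF Q hQ).irreducible.associated_of_dvd (hgenPrime F hF Q' hQ').irreducible hdvd
    have hspan : Ideal.span {F Q} = Ideal.span {F Q'} :=
      Ideal.span_singleton_eq_span_singleton.2 hass
    rw [hF Q hQ, hF Q' hQ'] at hspan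
    have heq : Q.radical = Q'.radical :=
      h4 m r _ _ hr hrm (hhom Q hQ) (hprime Q hQ) (hdim Q hQ) (hhom Q' hQ') (hprime Q' hQ')
        (hdim Q' hQ') hspan
    have hdis := ht.distinct (Finset.mem_coe.2 hQ) (Finset.mem_coe.2 hQ') hne
    apply hdis
    simp only [Submodule.colon_univ]
    exact heq
  -- the product formula
  have hprod : ∀ F : Ideal (Rx m) → RU r m,
      (∀ Q ∈ t, Ideal.span {F Q} = elimIdeal Q.radical r) →
        Ideal.span {∏ Q ∈ t, F Q ^ primaryExponent Q} = elimIdeal I r := by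
    intro F hF
    rw [(h1 m r hr hrm).2 I hI t ht, ← iInf_span_singleton_pow_eq_span_prod t F
      (fun Q => primaryExponent Q) (hgenPrime F hF) (hgenNotDvd F hF)]
    refine iInf_congr fun Q => iInf_congr fun hQ => ?_
    exact h3 m r I hr hrm hI hunm t ht Q hQ (F Q) (hF Q hQ)
  refine ⟨?_, fun Q hQ => (hprinc Q hQ).1, fun F hF => ⟨?_, hprod F hF⟩, ?_⟩
  · -- principality of `Ī(r)`: use the generators `chowForm √Q r`
    have hF₀ : ∀ Q ∈ t, Ideal.span {chowForm Q.radical r} = elimIdeal Q.radical r :=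
      fun Q hQ => span_chowForm _ r (hprinc Q hQ).1
    rw [← hprod (fun Q => chowForm Q.radical r) hF₀]
    exact ⟨⟨_, rfl⟩⟩
  · intro Q hQ
    exact (hgenPrime F hF Q hQ).irreducible
  · intro i
    exact blockDeg_chowForm_eq_ideg I hr i

end Nesterenko

end Literature.NumberTheory.Transcendental

end
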